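import Summits.ResolutionOfSingularities.ResolutionOfSingularities.Theorems.PurelyInseparableDim4SpineCert
import HarnessLib
import HarnessLib.Audit.Tags

/-!
# Purely inseparable fourfolds — SYMMETRIES of spine-cycle certificates (renaming the variables, rotation)

Census cell «res-dim4-pi» (D-0157 DOOR 2), WAVE-3 rows W3-3 / W3-13, seat res-dim4-p-8.
[OURS · counted 0 · AI kernel work, weaker than expert review.]  Nothing here is about resolution of
singularities itself; nothing here proves resolution in dimension ≥ 4 / characteristic `p`.

The kernel batches `PurelyInseparableDim4SpineCertBatchB*` certify ONE literal representative per
class of spine cycles up to ROTATION of the cycle and RENAMING of the four variables (`S₄`).  This file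
proves, once and for all and without `decide`, that both operations preserve certificates, so every one
of the 1 265 literal spine rows of engine B's census of record (and engine A's 1 161) is a certified
cycle as soon as its class representative is:

* §1 renaming on the computable mirror: `renameExp π a = a ∘ π⁻¹` (the new variable `π i` carries the
  old exponent of `i`), `renamePos`, and the equivariance of `degInC`, `chartExpC`, `pureMoveC`,
  `spineMoveC`, `wonB`, `permB`, `cardFirstB`, `stepB` (Hironaka's game is symmetric in the variables;
  cardinality-first is an `S₄`-invariant rule);
* §2 `CycleCert.rename`: a certificate stays a certificate after renaming every entry;
* §3 `CycleCert.rotate`: a certificate stays a certificate after rotating the list.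

[cite: Spivakovsky1983, §1 (Hironaka's polyhedra game; the rules are symmetric in the coordinates)];
bears_on: LADDER-RESOLUTION:D157-DOOR2 (res-dim4-pi · W3-3 · W3-13). Supports stmt-ResolutionOfSingularities-16155 (helper).
-/

-- cell convention (DR-157-C): the summit's doubled path segment is intended, as in the landed Target file
set_option linter.dupNamespace false

namespace Summit.ResolutionOfSingularities.ResolutionOfSingularities.Theorems.PIDim4.SpineCert

open Finset

/-! ## 1. Renaming the variables on the computable mirror -/

/-- Renaming of an exponent vector along `π`: the new variable `π i` carries the old exponent of `i`,
i.e. `renameExp π a = a ∘ π⁻¹`. [folklore] -/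
def renameExp (π : Equiv.Perm (Fin 4)) (a : Fin 4 → ℕ) : Fin 4 → ℕ := fun i => a (π.symm i)

/-- Renaming of a position. [folklore] -/
def renamePos (π : Equiv.Perm (Fin 4)) (A : Finset (Fin 4 → ℕ)) : Finset (Fin 4 → ℕ) :=
  A.image (renameExp π)

/-- Renaming of a certificate entry `(position, centre, chart)`. [folklore] -/
def renameEntry (π : Equiv.Perm (Fin 4)) (e : Finset (Fin 4 → ℕ) × Finset (Fin 4) × Fin 4) :
    Finset (Fin 4 → ℕ) × Finset (Fin 4) × Fin 4 :=
  (renamePos π e.1, e.2.1.image π, π e.2.2)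

variable (π : Equiv.Perm (Fin 4))

/-- `renameExp π a` evaluated at a renamed variable. [folklore] -/
@[simp] theorem renameExp_apply_perm (a : Fin 4 → ℕ) (i : Fin 4) : renameExp π a (π i) = a i := by
  simp [renameExp]

/-- Renaming exponent vectors is injective. [folklore] -/
theorem renameExp_injective : Function.Injective (renameExp π) := by
  intro a b h
  funext i
  have := congrFun h (π i)
  simpa using this

/-- Renaming positions is injective. [folklore] -/
theorem renamePos_injective : Function.Injective (renamePos π) :=
  fun _ _ h => Finset.image_injective (renameExp_injective π) h

/-- `Σ_{i ∈ π(J)} (π·a)ᵢ = Σ_{i∈J} aᵢ`. [folklore] -/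
theorem degInC_rename (J : Finset (Fin 4)) (a : Fin 4 → ℕ) :
    degInC (J.image π) (renameExp π a) = degInC J a := by
  unfold degInC
  rw [Finset.sum_image (fun x _ y _ h => π.injective h)]
  simp [renameExp]

/-- Total degree is invariant under renaming. [folklore] -/
theorem degInC_univ_rename (a : Fin 4 → ℕ) :
    degInC Finset.univ (renameExp π a) = degInC Finset.univ a := by
  have h := degInC_rename π Finset.univ a
  rwa [Finset.image_univ_equiv] at h

/-- The chart law commutes with renaming. [folklore] -/
theorem chartExpC_rename (q : ℕ) (J : Finset (Fin 4)) (j : Fin 4) (a : Fin 4 → ℕ) :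
    chartExpC q (J.image π) (π j) (renameExp π a) = renameExp π (chartExpC q J j a) := by
  funext i
  simp only [chartExpC, renameExp, Function.update_apply, degInC_rename]
  obtain ⟨i', rfl⟩ := π.surjective i
  simp [π.injective.eq_iff]

/-- The pure move commutes with renaming. [folklore] -/
theorem pureMoveC_rename (q : ℕ) (J : Finset (Fin 4)) (j : Fin 4) (A : Finset (Fin 4 → ℕ)) :
    pureMoveC q (J.image π) (π j) (renamePos π A) = renamePos π (pureMoveC q J j A) := by
  unfold pureMoveC renamePos
  rw [Finset.image_image, Finset.image_image]
  apply Finset.image_congr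
  intro a _
  exact chartExpC_rename π q J j a

/-- Being `q`-divisible in every coordinate is invariant under renaming. [folklore] -/
theorem forall_dvd_rename_iff (q : ℕ) (a : Fin 4 → ℕ) :
    (∀ i, q ∣ renameExp π a i) ↔ ∀ i, q ∣ a i := by
  constructor
  · intro h i
    simpa using h (π i)
  · intro h i
    exact h (π.symm i)

/-- The spine move (with deletions) commutes with renaming. [folklore] -/
theorem spineMoveC_rename (q : ℕ) (J : Finset (Fin 4)) (j : Fin 4) (A : Finset (Fin 4 → ℕ)) :
    spineMoveC q (J.image π) (π j) (renamePos π A) = renamePos π (spineMoveC q J j A) := by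
  unfold spineMoveC
  rw [pureMoveC_rename]
  unfold renamePos
  rw [Finset.filter_image]
  congr 1
  apply Finset.filter_congr
  intro a _
  rw [forall_dvd_rename_iff]

/-- The winning test is invariant under renaming. [folklore] -/
theorem wonB_rename (q : ℕ) (A : Finset (Fin 4 → ℕ)) : wonB q (renamePos π A) = wonB q A := by
  unfold wonB renamePos
  rw [decide_eq_decide]
  refine or_congr Finset.image_eq_empty ?_
  rw [Finset.exists_mem_image]
  simp only [degInC_univ_rename]

/-- Permissibility is equivariant under renaming. [folklore] -/
theorem permB_rename (q : ℕ) (J : Finset (Fin 4)) (A : Finset (Fin 4 → ℕ)) :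
    permB q (J.image π) (renamePos π A) = permB q J A := by
  unfold permB renamePos
  rw [decide_eq_decide]
  refine and_congr (Finset.image_nonempty) ?_
  rw [Finset.forall_mem_image]
  simp only [degInC_rename]

/-- Every `J' ⊆ {x₁..x₄}` is the renaming of some `J''`. [folklore] -/
theorem exists_image_eq (J' : Finset (Fin 4)) : ∃ J'' : Finset (Fin 4), J''.image π = J' :=
  ⟨J'.image π.symm, by rw [Finset.image_image]; simp⟩

/-- Cardinality-first is equivariant under renaming (`S₄` maps permissible centres to permissible
centres bijectively and preserves cardinality). [folklore] -/
theorem cardFirstB_rename (q : ℕ) (J : Finset (Fin 4)) (A : Finset (Fin 4 → ℕ)) :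
    cardFirstB q (J.image π) (renamePos π A) = cardFirstB q J A := by
  unfold cardFirstB
  rw [permB_rename]
  congr 1
  rw [decide_eq_decide, Finset.card_image_of_injective _ π.injective]
  constructor
  · intro h J' hJ'
    have := h (J'.image π) (by rwa [permB_rename])
    rwa [Finset.card_image_of_injective _ π.injective] at this
  · intro h J' hJ'
    obtain ⟨J'', rfl⟩ := exists_image_eq π J'
    rw [permB_rename] at hJ'
    rw [Finset.card_image_of_injective _ π.injective]
    exact h J'' hJ'

/-- A certified edge stays certified after renaming. [folklore] -/
theorem stepB_rename (q : ℕ) (A : Finset (Fin 4 → ℕ)) (J : Finset (Fin 4)) (j : Fin 4)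
    (A' : Finset (Fin 4 → ℕ)) :
    stepB q (renamePos π A) (J.image π) (π j) (renamePos π A') = stepB q A J j A' := by
  unfold stepB
  rw [wonB_rename, cardFirstB_rename, pureMoveC_rename]
  have h1 : decide (π j ∈ J.image π) = decide (j ∈ J) := by
    rw [decide_eq_decide]
    exact π.injective.mem_finset_image
  have h2 : decide (renamePos π (pureMoveC q J j A) = renamePos π A') = decide (pureMoveC q J j A = A') := by
    rw [decide_eq_decide]
    exact (renamePos_injective π).eq_iff
  rw [h1, h2]

/-! ## 2. Certificates are stable under renaming -/

namespace CycleCert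

variable {π}
variable {q : ℕ} {L : List (Finset (Fin 4 → ℕ) × Finset (Fin 4) × Fin 4)}

/-- **Renaming the four variables maps cycle certificates to cycle certificates.** [folklore] -/
theorem rename (h : CycleCert q L) (π : Equiv.Perm (Fin 4)) : CycleCert q (L.map (renameEntry π)) := by
  obtain ⟨hne, hnd, hstep⟩ := h
  refine ⟨by simpa using hne, ?_, ?_⟩
  · rw [List.map_map]
    have : Prod.fst ∘ renameEntry π = renamePos π ∘ Prod.fst := by
      funext e
      rfl
    rw [this, ← List.map_map]
    exact hnd.map (renamePos_injective π)
  · intro k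
    have hk : k.1 < L.length := by simpa using k.2
    have hs := hstep ⟨k.1, hk⟩
    simp only [List.get_eq_getElem, List.getElem_map, List.length_map] at hs ⊢
    rw [← hs]
    exact stepB_rename π q _ _ _ _

end CycleCert

/-! ## 3. Certificates are stable under rotation -/

namespace CycleCert

variable {q : ℕ} {L : List (Finset (Fin 4 → ℕ) × Finset (Fin 4) × Fin 4)}

/-- **Rotating the list maps cycle certificates to cycle certificates.** [folklore] -/
theorem rotate (h : CycleCert q L) (n : ℕ) : CycleCert q (L.rotate n) := by
  obtain ⟨hne, hnd, hstep⟩ := h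
  have hlen : 0 < L.length := List.length_pos_iff.mpr hne
  refine ⟨?_, ?_, ?_⟩
  · intro h0
    apply hne
    have := congrArg List.length h0
    simpa using this
  · rw [List.map_rotate]
    exact (List.nodup_rotate).mpr hnd
  · intro k
    have hkL : k.1 < L.length := by simpa using k.2
    -- the entry of the rotated list at `k` is the entry of `L` at `(k + n) % |L|`
    have hidx : (k.1 + n) % L.length < L.length := Nat.mod_lt _ hlen
    have hs := hstep ⟨(k.1 + n) % L.length, hidx⟩
    simp only [List.get_eq_getElem, List.length_rotate] at hs ⊢
    rw [List.getElem_rotate, List.getElem_rotate]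
    have e1 : ((k.1 + 1) % L.length + n) % L.length = ((k.1 + n) % L.length + 1) % L.length := by
      rw [Nat.mod_add_mod, Nat.mod_add_mod, Nat.add_right_comm]
    simp only [e1]
    exact hs

/-- Renaming followed by rotation preserves certificates: the form in which the census rows are
covered by the class representatives of the batch files. [folklore] -/
theorem rename_rotate (h : CycleCert q L) (π : Equiv.Perm (Fin 4)) (n : ℕ) :
    CycleCert q ((L.map (renameEntry π)).rotate n) :=
  (h.rename π).rotate n

end CycleCert

end Summit.ResolutionOfSingularities.ResolutionOfSingularities.Theorems.PIDim4.SpineCert
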